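import Mathlib
import Summits.PneNP.PneNP.Theorems.Nc03AvoidResidualCoreReductionBal
import Summits.PneNP.PneNP.Theorems.Nc03AvoidResidualCoreReductionFcyc

/-!
# Route Nc03AvoidResidualCore, item `ResidualCoreReduction` — the fundamental cycle is a balanced trail

Helper file for `stmt-PneNP-20227` (sequel of `…ReductionBal`, `…ReductionFcyc`; cell pnp-ideate).
The edge sequence `cyc E e` of the fundamental cycle of a non-forest edge `e ∈ E` is split into
its even edges `fte E e k = cyc (2k)` and odd edges `ftd E e k = cyc (2k+1)` (`k < hl = clen/2`);
these satisfy the hypotheses of `bal_trail`, so the pattern `fcol E e` ("`true` on the even edges")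
is balanced on the edge set `fcycle E e`, which contains `e`, lies in `E`, and apart from `e`
consists of forest edges. [folklore]
-/

set_option linter.dupNamespace false -- `Summit.PneNP.PneNP.…`: summit = sub-problem name (D-0017 single-conjunct layout)

namespace Summit.PneNP.PneNP.Theorems.Nc03Reduction

open Finset

namespace Bip

variable {ι W : Type*} (G : Bip ι W) [LinearOrder W] [Fintype W] [LinearOrder ι] [Inhabited ι]

noncomputable section
open Classical

section FcycB

variable (E : Finset ι) (e : ι)

/-- Half the length of the fundamental cycle. -/
def hl : ℕ := G.clen E e / 2

/-- The even edges of the fundamental cycle. -/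
def fte (k : ℕ) : ι := G.cyc E e (2 * k)

/-- The odd edges of the fundamental cycle. -/
def ftd (k : ℕ) : ι := G.cyc E e (2 * k + 1)

/-- The edge set of the fundamental cycle. -/
def fcycle : Finset ι := (range (G.hl E e)).image (G.fte E e) ∪ (range (G.hl E e)).image (G.ftd E e)

/-- The alternating pattern of the fundamental cycle: `true` exactly on its even edges. -/
def fcol (j : ι) : Bool := decide (j ∈ (range (G.hl E e)).image (G.fte E e))

variable {E e}

/-- Twice the half length is the length. -/
theorem two_hl (he : e ∈ E) : 2 * G.hl E e = G.clen E e := by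
  obtain ⟨r, hr⟩ := G.even_clen he
  unfold hl; omega

/-- The half length is positive. -/
theorem hl_pos (he : e ∈ E) : 0 < G.hl E e := by
  have h := G.two_hl he
  unfold clen at h; omega

/-- The length in terms of `kb, ka`. -/
theorem clen_eq : G.clen E e = G.kb E e + G.ka E e + 1 := rfl

/-- The B-endpoint of an even edge is the boundary vertex before... i.e. `bd (2k)`. -/
theorem eB_fte (he : e ∈ E) {k : ℕ} (hk : k < G.hl E e) : G.eB (G.fte E e k) = G.bd E e (2 * k) := by
  have h2 := G.two_hl he
  rw [G.clen_eq] at h2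
  rcases Nat.eq_zero_or_pos k with h0 | h0
  · subst h0; unfold fte; rw [Nat.mul_zero, G.cyc_zero, G.bd_zero]
  · obtain ⟨-, hmem⟩ := G.bd_mem_ends he (i := 2 * k) (by omega) (by omega)
    have hs := G.side_bd he (2 * k) (by omega)
    rw [show decide (Even (2 * k)) = true from by simp] at hs
    exact (G.eq_eB_of_side hmem hs).symm

/-- The B-endpoint of an odd edge is `bd (2k)`. -/
theorem eB_ftd (he : e ∈ E) {k : ℕ} (hk : k < G.hl E e) : G.eB (G.ftd E e k) = G.bd E e (2 * k) := by
  have h2 := G.two_hl he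
  rw [G.clen_eq] at h2
  obtain ⟨hmem, -⟩ := G.bd_mem_ends he (i := 2 * k + 1) (by omega) (by omega)
  rw [Nat.add_sub_cancel] at hmem
  have hs := G.side_bd he (2 * k) (by omega)
  rw [show decide (Even (2 * k)) = true from by simp] at hs
  exact (G.eq_eB_of_side hmem hs).symm

/-- The A-endpoint of an odd edge is `bd (2k+1)`. -/
theorem eA_ftd (he : e ∈ E) {k : ℕ} (hk : k < G.hl E e) : G.eA (G.ftd E e k) = G.bd E e (2 * k + 1) := by
  have h2 := G.two_hl he
  rw [G.clen_eq] at h2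
  obtain ⟨-, hmem⟩ := G.bd_mem_ends he (i := 2 * k + 1) (by omega) (by omega)
  have hs := G.side_bd he (2 * k + 1) (by omega)
  rw [show decide (Even (2 * k + 1)) = false from by simp] at hs
  exact (G.eq_eA_of_side hmem hs).symm

/-- The A-endpoint of the next even edge (cyclically) is `bd (2k+1)`. -/
theorem eA_fte_succ (he : e ∈ E) {k : ℕ} (hk : k < G.hl E e) :
    G.eA (G.fte E e ((k + 1) % G.hl E e)) = G.bd E e (2 * k + 1) := by
  have h2 := G.two_hl he
  rw [G.clen_eq] at h2
  rcases Nat.lt_or_ge (k + 1) (G.hl E e) with h | h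
  · rw [Nat.mod_eq_of_lt h]
    obtain ⟨hmem, -⟩ := G.bd_mem_ends he (i := 2 * (k + 1)) (by omega) (by omega)
    rw [show 2 * (k + 1) - 1 = 2 * k + 1 by omega] at hmem
    have hs := G.side_bd he (2 * k + 1) (by omega)
    rw [show decide (Even (2 * k + 1)) = false from by simp] at hs
    exact (G.eq_eA_of_side hmem hs).symm
  · have hk1 : k + 1 = G.hl E e := by omega
    rw [hk1, Nat.mod_self]
    unfold fte
    rw [Nat.mul_zero, G.cyc_zero, show 2 * k + 1 = G.kb E e + G.ka E e by omega, G.bd_last he]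

/-- Even edges are pairwise distinct. -/
theorem fte_inj (he : e ∈ E) (heT : e ∉ G.forest E) {k k' : ℕ} (hk : k < G.hl E e)
    (hk' : k' < G.hl E e) (h : G.fte E e k = G.fte E e k') : k = k' := by
  have h2 := G.two_hl he
  rw [G.clen_eq] at h2
  unfold fte at h
  rcases Nat.eq_zero_or_pos k with h0 | h0 <;> rcases Nat.eq_zero_or_pos k' with h0' | h0'
  · omega
  · subst h0; rw [Nat.mul_zero, G.cyc_zero] at h
    exact absurd h.symm (G.cyc_ne_zero he heT (by omega) (by omega))
  · subst h0'; rw [Nat.mul_zero, G.cyc_zero] at h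
    exact absurd h (G.cyc_ne_zero he heT (by omega) (by omega))
  · have := G.cyc_injOn he (by omega) (by omega) (by omega) (by omega) h
    omega

/-- Odd edges are pairwise distinct. -/
theorem ftd_inj (he : e ∈ E) {k k' : ℕ} (hk : k < G.hl E e) (hk' : k' < G.hl E e)
    (h : G.ftd E e k = G.ftd E e k') : k = k' := by
  have h2 := G.two_hl he
  rw [G.clen_eq] at h2
  unfold ftd at h
  have := G.cyc_injOn he (by omega) (by omega) (by omega) (by omega) h
  omega

/-- Even and odd edges differ. -/
theorem fte_ne_ftd (he : e ∈ E) (heT : e ∉ G.forest E) {k k' : ℕ} (hk : k < G.hl E e)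
    (hk' : k' < G.hl E e) : G.fte E e k ≠ G.ftd E e k' := by
  have h2 := G.two_hl he
  rw [G.clen_eq] at h2
  intro h
  unfold fte ftd at h
  rcases Nat.eq_zero_or_pos k with h0 | h0
  · subst h0; rw [Nat.mul_zero, G.cyc_zero] at h
    exact G.cyc_ne_zero he heT (by omega) (by omega) h.symm
  · have := G.cyc_injOn he (by omega) (by omega) (by omega) (by omega) h
    omega

/-- **The fundamental cycle is balanced.** -/
theorem bal_fcycle (he : e ∈ E) (heT : e ∉ G.forest E) : G.Bal (G.fcycle E e) (G.fcol E e) :=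
  G.bal_trail (G.hl E e) (G.hl_pos he) (G.fte E e) (G.ftd E e)
    (fun k hk => by rw [G.eB_fte he hk, G.eB_ftd he hk])
    (fun k hk => by rw [G.eA_ftd he hk, G.eA_fte_succ he hk])
    (fun k hk k' hk' h => G.fte_inj he heT hk hk' h)
    (fun k hk k' hk' h => G.ftd_inj he hk hk' h)
    (fun k hk k' hk' => G.fte_ne_ftd he heT hk hk')

/-- Membership in the fundamental cycle: being one of the `cyc i`, `i < clen`. -/
theorem mem_fcycle (he : e ∈ E) {j : ι} : j ∈ G.fcycle E e ↔ ∃ i < G.clen E e, G.cyc E e i = j := by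
  have h2 := G.two_hl he
  unfold fcycle fte ftd
  simp only [Finset.mem_union, Finset.mem_image, Finset.mem_range]
  constructor
  · rintro (⟨k, hk, rfl⟩ | ⟨k, hk, rfl⟩)
    · exact ⟨2 * k, by omega, rfl⟩
    · exact ⟨2 * k + 1, by omega, rfl⟩
  · rintro ⟨i, hi, rfl⟩
    obtain ⟨k, hk⟩ := Nat.even_or_odd' i
    rcases hk with rfl | rfl
    · exact Or.inl ⟨k, by omega, rfl⟩
    · exact Or.inr ⟨k, by omega, rfl⟩

/-- The edge itself lies on its fundamental cycle. -/
theorem self_mem_fcycle (he : e ∈ E) : e ∈ G.fcycle E e :=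
  (G.mem_fcycle he).2 ⟨0, by unfold clen; omega, G.cyc_zero⟩

/-- The other edges of the fundamental cycle are forest edges. -/
theorem mem_forest_of_mem_fcycle (he : e ∈ E) {j : ι} (hj : j ∈ G.fcycle E e) (hje : j ≠ e) :
    j ∈ G.forest E := by
  obtain ⟨i, hi, rfl⟩ := (G.mem_fcycle he).1 hj
  rcases Nat.eq_zero_or_pos i with h0 | h0
  · subst h0; exact absurd G.cyc_zero hje
  · exact G.cyc_mem_forest he h0 (by unfold clen at hi; omega)

/-- The fundamental cycle lies in `E`. -/
theorem fcycle_subset (he : e ∈ E) : G.fcycle E e ⊆ E := by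
  intro j hj
  by_cases hje : j = e
  · rw [hje]; exact he
  · exact G.forest_subset E (G.mem_forest_of_mem_fcycle he hj hje)

/-- The pattern of the fundamental cycle is supported on it. -/
theorem mem_fcycle_of_fcol {j : ι} (h : G.fcol E e j = true) : j ∈ G.fcycle E e := by
  unfold fcol at h; unfold fcycle
  rw [decide_eq_true_eq] at h
  exact Finset.mem_union.2 (Or.inl h)

/-- The edge itself is coloured `true`. -/
theorem fcol_self (he : e ∈ E) : G.fcol E e e = true := by
  unfold fcol
  rw [decide_eq_true_eq, Finset.mem_image]
  exact ⟨0, Finset.mem_range.2 (G.hl_pos he), by unfold fte; rw [Nat.mul_zero, G.cyc_zero]⟩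

end FcycB

end

end Bip

end Summit.PneNP.PneNP.Theorems.Nc03Reduction
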